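import Summits.BirchSwinnertonDyer.Rank1Residual.X1.KellerYinGoodLattice
import HarnessLib

/-!
# THEOREM A of the cell `bsd-eis` in the kernel: `BSD(E,p)` for every `E/ℚ` of analytic rank one at a
# good ANOMALOUS Eisenstein prime `p > 2` of parity type A, from Keller–Yin's IMC2 at the trivial
# character for the good lattice (the ONE `_OPEN` input) and published theorems
# (seat `bsd-eis-ky`, `HOME/bsd-eis-ky-MEMO-1.md` §2 links L1–L14 — file 2 of 2)

HONEST FRAMING (cell `bsd-eis`, home `run/shared/lean/pub/bsd-eis/`; FULL-BSD rank-≤1 programme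
D-0033, row A1 = X1a, 7 892 open census cells). THEOREMS ONLY (no definition, no named fact, no
`sorry`); nothing booked, no label moved: row A1 stays as labelled until the planner / coordinator
rule. What this file establishes is the CONDITIONAL STRUCTURE of row A1 in the kernel: `BSD(E,p)` on
X1 ∩ {type A, `r_an = 1`} follows from
* ONE preprint statement, `KellerYin2024.thm308_imc2_bdpValue_goodLattice_OPEN` (`h308`: Keller–Yin
  arXiv:2402.12781v2 Thm. 3.0.8 (IMC2) for the good lattice at `𝟙` ∘ [CGLS] Thm. 5.1.3;
  `[claim: KellerYin2024, status: under-review]`; verified line by line in the cell memo §2–§3, referee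
  PASS) — NOT Keller–Yin's Thm. 4.2.1 / the whole display (`thm421_rankOne_display_OPEN`, the binder
  of x1a's `bsdp_of_classX1_typeA_of_analyticRank_eq_one_of_KY_OPEN`), NOT their Appendix B control
  theorem, NOT their weight-`2r` Kolyvagin-system theorem `Koly` (Longo–Vigni import), and NO cyclotomic
  main conjecture at type A;
* PUBLISHED named facts: [CGLS] Thm. 5.1.1 as proved under `E(K)[p] = 0`
  (`thm511_anticyclotomicControl_of_torsionFree`), Greenberg–Vatsal 2000 Thm. 1.3 (Mazur's main
  conjecture for the TYPE-B quadratic-twist partner, [CGLS] Thm. 5.1.4), Greenberg LNM 1716 Thm. 4.1,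
  modularity, Hoffstein–Luo 1997 (an admissible `K`), Gross–Zagier 1986 (I.7.3 over `ℚ`; V.§2 over
  `K`), Kolyvagin 1990, Gross–Zagier–Kolyvagin, Cassels 1965 / Milne ADT I.7.3 (isogeny invariance
  of the BSD quotient);
* the existence, in the isogeny class, of KY's normalised member `E'` ("no rational `p`-line
  unramified at `p`"; Ribet's lemma, KY Prop. 1.3.1) — the hypothesis `hiso`/`hGL` of §3, a finite
  check per class (`11a2` for `11a` at `5`); proving it class-wide in the kernel (the `p`-isogeny graph
  has a leaf with ramified kernel) is left to the successor.

## Contents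

* §1 `display57_at_goodLattice` — (5.5) (file 1) + (5.6) (Gross–Zagier, `p`-adically:
  `TwistIdentity.padicValRat_add_eq_of_grossZagier`) ⇒ [CGLS] (5.7) for the good lattice, with the
  torsion index over `K` killed by `p ∤ #E'(K)_tors` (file 1) — verbatim lit-cgls's
  `TwistIdentity.display57_at_of_display55` except at the two marked places.
* §2 `display_at_goodLattice` — the Keller–Yin display (body of `KellerYin2024.thm421_rankOne_display_OPEN`)
  AT ONE admissible `(E', p, K, Wd)`, now a theorem from `h308` + published facts (Heegner datum
  produced as in `display57_of_display55`; torsion terms vanish by file 1);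
  `bsdp_goodLattice_of_not_gvPar_of_analyticRank_eq_one` — **`BSD(E',p)` for the good lattice of a
  rank-one type-A X1 pair** (admissible `K` by Hoffstein–Luo; partner's rank-`0` print shape by
  Greenberg–Vatsal, `pPartRankZero_twist_of_not_gvPar`; then x1a's `bsdp_of_display_at_of_pPartRankZero`).
* §3 `bsdp_of_isIsogenous_goodLattice_of_not_gvPar_of_analyticRank_eq_one` — **`BSD(E,p)` for EVERY
  member `E` of the class** (hypotheses on the census curve; Cassels via `Wuthrich2014.bsdp_of_isIsogenous`).

## Riders recorded (memo §10 «what this is NOT»; planner ROUTING v1.5 (1))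

No `p ≥ 5`, no `p ∤ φ(N)`, no `p ∤ h_K` binder: the weight-2 Kolyvagin system behind `h308` is
[CGLS] Thm. 4.1.1 / Howard 2004 (`p` odd; `p, D, N` coprime), not KY's `Koly` / Longo–Vigni; the
8 173 pairs of row A1 at `p = 3` inherit no rider. No Schneider / `p`-adic height (the road is
anticyclotomic). No non-CM binder in the statements: the memo's verification of `h308` uses "`E`
non-CM" only for the error-term constants of Howard's theorem (memo L6; KY Lemma 3.0.7 treats general
`f`), i.e. inside the OPEN hypothesis. `p = 2` is excluded by `ClassX1`.

References: [KellerYin2024] arXiv:2402.12781v2 Thm. 4.2.1 (= Theorem C) and §4.2, Thm. 3.0.8,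
Prop. 1.3.1; [CastellaGrossiLeeSkinner2022] Thm. 5.3.1 and its proof (5.4)–(5.7), Thms. 5.1.1–5.1.4;
[GreenbergVatsal2000] Thm. (1.3); [GrossZagier1986] I.7.3, V.§2; [HoffsteinLuo1997]; [MilneADT2006]
I.7.3; [Miller2011LMS] Def. 1.1; HOME/bsd-eis-ky-MEMO-1.md §2, §8–§11; HOME/TARGET.md §1.1.
-/

set_option autoImplicit false

noncomputable section

open scoped Classical

open WeierstrassCurve NumberField IsDedekindDomain Field Literature.NumberTheory.EllipticCurves
  Literature.NumberTheory.EllipticCurves.ModularForms Literature.NumberTheory.QuadraticFields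
  Literature.NumberTheory.EllipticCurves.Rank1Residual
  Literature.NumberTheory.EllipticCurves.CastellaGrossiLeeSkinner2022
  Literature.NumberTheory.EllipticCurves.Castella2018
  Literature.NumberTheory.EllipticCurves.KrizLi2019
  Literature.NumberTheory.GaloisRepresentations
  Literature.NumberTheory.EllipticCurves.KellerYin2024
  Summit.BirchSwinnertonDyer.Rank1Residual.X1.KellerYinGoodLattice

namespace Summit.BirchSwinnertonDyer.Rank1Residual.X1.KellerYinTheoremA

/-! ## §1 Display (5.7) for the good lattice: "(5.5) + (5.6) ⇒ (5.7)", with NO torsion at `p` over `K` -/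

/-- **(5.5) ⇒ (5.7) for the good lattice at an anomalous prime, at one admissible `(E', p, K, Wd)`
and one Heegner datum** — the step "combining (5.5) and (5.6) we arrive at (5.7)" of [CGLS] IN THE
KERNEL, verbatim the cell's `TwistIdentity.display57_at_of_display55` (lit-cgls session 4) except at
two places: (i) (5.5) comes from §2 (KY IMC2 at `𝟙` ∘ BDP + control-as-proved, for the good lattice),
not from the published non-anomalous display; (ii) the vanishing of the torsion terms `ord_p #E'(ℚ)_tors`,
`ord_p #E'^K(ℚ)_tors` is NOT "`a_p ≢ 1`" (false here: `p` IS anomalous) but `p ∤ #E'(K)_tors` for the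
good lattice (`KellerYinGoodLattice.not_dvd_torsionOrder_baseChange_of_noUnramifiedLine`), which kills the torsion
index of (5.6) over `K` directly (so the descent of the torsion from `K` to `ℚ` is not even needed).
Data: `W/ℚ` globally minimal elliptic of conductor `N` — the GOOD LATTICE (no unramified rational
`p`-line) —, `p > 2` good with `E[p]` reducible and `a_p ≡ 1 (mod p)`, `ord_{s=1}L(E,s) = 1`; `K`
admissible ((a) `d_K` odd `< −4`, (b) every `ℓ ∣ N` split, (c) `p` split, (d) `L(E^{(d_K)},1) ≠ 0`);
a datum `(Dt, H, ι, P)` of level `N` (ANY Manin constant: it cancels); `Wd` a globally minimal model of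
`E^{(d_K)}`; the rationals `q`, `q_d`. Other inputs as there: (5.6) `p`-adically
(`TwistIdentity.padicValRat_add_eq_of_grossZagier`: Gross–Zagier + Kolyvagin + GZK + modularity), the
odd part of `Ш` under `K/ℚ`, the Tamagawa relation at every odd `p`.
Conclusion: `[ord_p q − ord_p ∏c(E') − ord_p #Ш(E')] = −[ord_p q_d − ord_p ∏c(E'^K) − ord_p #Ш(E'^K)]`.
[claim: KellerYin2024, status: under-review]
[cite: KellerYin2024, proof of Thm. 4.2.1 (arXiv:2402.12781v2 §4.2, "equation (5.7) in [CGLS] becomes …")]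
[cite: CastellaGrossiLeeSkinner2022, proof of Thm. 5.3.1, displays (5.5)–(5.7) and the sentence between them]
[cite: GrossZagier1986, V.§2 (pp. 310–312)] [cite: JetchevSkinnerWan2017, §7.4.1] -/
theorem display57_at_goodLattice (h308 : thm308_imc2_bdpValue_goodLattice_OPEN)
    (h511 : thm511_anticyclotomicControl_of_torsionFree)
    (W : WeierstrassCurve ℚ) [W.IsElliptic] [W.IsGloballyMinimal] (p : ℕ) [Fact p.Prime]
    (N : ℕ) [NeZero N] (K : Type) [Field K] [NumberField K]
    (Dt : ModularParametrizationData W N) (H : HeegnerDatum N (NumberField.discr K)) (ι : K →+* ℂ)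
    (P : (W.baseChange K).toAffine.Point)
    (hGZ : gross_zagier N W K) (hKo : kolyvagin N W K)
    (hGZK : rank_eq_analyticRank_of_analyticRank_le_one) (hmod : hasEntireLFunction_rat)
    (hp : 2 < p) (hgood : Good W p) (hred : Red W p) (han : Anom W p)
    (hGL : ∀ Φ : AddSubgroup (geomTorsion W (p : ℤ)), IsRationalLine W p Φ → ¬ LineUnramifiedAt W p Φ)
    (hr : W.analyticRank = 1)
    (hN : W.conductorNorm ℤ = N) (hK : IsImaginaryQuadratic K) (hodd : Odd (NumberField.discr K))
    (hlt : NumberField.discr K < -4) (hHN : SatisfiesHeegnerHypothesis N K)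
    (hHp : SatisfiesHeegnerHypothesis p K)
    (hLt : (W.quadraticTwist (NumberField.discr K : ℚ)).entireLFunction 1 ≠ 0)
    (hP : WeierstrassCurve.Affine.Point.map ι.toRatAlgHom P = heegnerPointComplex Dt H)
    (Wd : WeierstrassCurve ℚ) [Wd.IsElliptic] [Wd.IsGloballyMinimal]
    (hWd : ∃ C : VariableChange ℚ, C • Wd = W.quadraticTwist (NumberField.discr K : ℚ))
    (q qd : ℚ) (hq : W.leadingLCoeff / ((W.realPeriodRat * W.regulator : ℝ) : ℂ) = (q : ℂ))
    (hqd : Wd.entireLFunction 1 / (Wd.realPeriodRat : ℂ) = (qd : ℂ)) :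
    padicValRat p q - padicValNat p W.tamagawaProduct - padicValNat p W.shaOrder =
      -(padicValRat p qd - padicValNat p Wd.tamagawaProduct - padicValNat p Wd.shaOrder) := by
  -- adapted from `TwistIdentity.display57_at_of_display55` (lit-cgls session 4); changes at (i), (ii)
  have hpp : p.Prime := Fact.out
  have hp2 : p ≠ 2 := by omega
  haveI hEK : (W.baseChange K).IsElliptic := isElliptic_baseChange' W K
  have h2 : Module.finrank ℚ K = 2 := hK.1
  have hHN' : SatisfiesHeegnerHypothesis (W.conductorNorm ℤ) K := by rw [hN]; exact hHN
  have hD0 : (NumberField.discr K : ℚ) ≠ 0 := by exact_mod_cast NumberField.discr_ne_zero K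
  haveI hEt : (W.quadraticTwist (NumberField.discr K : ℚ)).IsElliptic :=
    W.isElliptic_quadraticTwist hD0
  -- the inverse change of variables `Cd • E^{(d_K)} = Wd`
  obtain ⟨C, hC⟩ := hWd
  set Cd : VariableChange ℚ := C⁻¹ with hCd_def
  have hCd : Cd • W.quadraticTwist (NumberField.discr K : ℚ) = Wd := by rw [← hC, inv_smul_smul]
  -- `p ∤ d_K` (split), `p ∤ w_K = 2` (`d_K < -4`), `ord_p u(Cd) = 0` (minimal twist, `p` split)
  have hpd : ¬ (p : ℤ) ∣ NumberField.discr K := not_dvd_discr_of_split hK hpp hp2 hHp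
  have hμ : ¬ p ∣ Units.torsionOrder K := X2.not_dvd_unitsTorsionOrder_of_discr_lt hK hlt hpp hp2
  have hu : padicValRat p (Cd.u : ℚ) = 0 :=
    AdditivePotMult.padicValRat_u_eq_zero_of_twist_minimal_of_split W p K hK hHp Cd hCd
  ---------------------------------------------------------------- Kolyvagin: `Ш(E/K)` finite, ranks
  have hL0 : W.entireLFunction 1 = 0 := entireLFunction_one_eq_zero_of_analyticRank_eq_one hr
  obtain ⟨-, hderiv⟩ := leadingLCoeff_eq_deriv_of_analyticRank_eq_one hr
  have hprod := lDerivEK_eq_deriv_mul W K hmod hL0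
  have hLK : LDerivEK W K ≠ 0 := by
    rw [hprod]; exact mul_ne_zero hderiv hLt
  have hPH : IsHeegnerPoint N W K P := ⟨Dt, H, ι, hP⟩
  have hPinf : ¬ IsOfFinAddOrder P :=
    (lDerivEK_ne_zero_iff_not_isOfFinAddOrder W N K hGZ hK hHN hPH).mp hLK
  obtain ⟨hrkK, hShaK⟩ := hKo hK hHN hPH hPinf
  haveI hfinK : Finite (W.baseChange K).sha := hShaK
  haveI hfinW : Finite W.sha := Literature.NumberTheory.EllipticCurves.shaFinite_of_baseChange W K hShaK
  have hrt : (W.quadraticTwist (NumberField.discr K : ℚ)).analyticRank = 0 :=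
    ((W.quadraticTwist _).analyticRank_eq_zero_iff_holds (hmod _)).2 hLt
  have hrd : Wd.analyticRank = 0 := by rw [← hCd, analyticRank_smul, hrt]
  obtain ⟨-, hShad⟩ := hGZK Wd (by omega)
  haveI hfinSd : Finite Wd.sha := hShad
  ---------------------------------------------------------------- (i) (5.5) at the datum, for the good lattice
  -- the anticyclotomic datum of Thm. 5.1.1 / Thm. 3.0.8: `κ, γ`, a degree-one `𝔭 ∋ p`, THE embedding, `v`, `v̄`
  obtain ⟨κ, γ, 𝔭, hκ, hγ, h𝔭, he, hf⟩ := X11b.exists_anticyclotomic_generator_degreeOnePrime p K hK hHp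
  haveI : Fact (κ.IsTopGenerator γ) := ⟨hγ⟩
  obtain ⟨vbar, hvbar, hne⟩ := X11b.exists_other_prime hHp (X11b.inducedPlace (X11b.embAt K p 𝔭 h𝔭 he hf))
    (X11b.natCast_mem_inducedPlace _)
  have h5 := display55_at_goodLattice h308 h511 hp hgood hred han hGL hK hodd (by omega) hHN' hHp
    (X11b.embAt K p 𝔭 h𝔭 he hf) (X11b.inducedPlace (X11b.embAt K p 𝔭 h𝔭 he hf)) vbar
    (X11b.mem_inducedPlace_iff _) hvbar hne κ hκ γ Dt H ι P hP hrkK hfinK hPinf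
  ---------------------------------------------------------------- (5.6) `p`-adically
  have h6 := TwistIdentity.padicValRat_add_eq_of_grossZagier W p N K Dt H ι P hGZ hKo hGZK hmod hK hHN
    hP hp2 hμ hr hLt Wd Cd hCd hu q qd hq hqd
  ---------------------------------------------------------------- the odd parts under `K/ℚ`
  -- `Ш`: `v_p(#Ш(E/K)) = v_p(#Ш(E)) + v_p(#Ш(E^K))`
  have hsha : padicValNat p (W.baseChange K).shaOrder =
      padicValNat p W.shaOrder + padicValNat p Wd.shaOrder := by
    have hcard := card_primaryComponent_sha_baseChange_quadratic_of_odd_of_finite W K h2 Wd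
      ⟨Cd, hCd⟩ (W.baseChange K) ⟨1, one_smul _ _⟩ p hp2
    rw [WeierstrassCurve.shaOrder, WeierstrassCurve.shaOrder, WeierstrassCurve.shaOrder,
      ← (Nat.pow_right_injective hpp.two_le).eq_iff, pow_add,
      ← natCard_primaryComponent_eq_pow_padicValNat p, ← natCard_primaryComponent_eq_pow_padicValNat p,
      ← natCard_primaryComponent_eq_pow_padicValNat p]
    exact hcard
  -- Tamagawa: `v_p(∏_w c_w(E/K)) = v_p(∏c(E)) + v_p(∏c(E^K))` at the odd `p ∤ d_K`
  have htam : padicValNat p (W.baseChange K).tamagawaProduct =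
      padicValNat p W.tamagawaProduct + padicValNat p Wd.tamagawaProduct :=
    X11b.padicValNat_tamagawaProduct_baseChange_quadratic_of_heegner_of_odd W p K Wd hp2 hK hodd hpd
      hHN' hCd
  ---------------------------------------------------------------- (ii) no `p`-torsion over `K` for the good lattice
  have htK : padicValNat p (W.baseChange K).torsionOrder = 0 :=
    padicValNat.eq_zero_of_not_dvd (not_dvd_torsionOrder_baseChange_of_noUnramifiedLine hGL hK hHp)
  ---------------------------------------------------------------- combine
  omega

/-! ## §2 The Keller–Yin display and `BSD(E',p)` for the good lattice of a type-A rank-one X1 pair -/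

section Assembly

variable {p : ℕ} [Fact p.Prime]

/-- **The Keller–Yin display for the good lattice at one admissible `(E', p, K, Wd)`** — the
rank-one identity of the proof of KY Thm. 4.2.1 (arXiv:2402.12781v2 §4.2: "equation (5.7) in [CGLS]
becomes …"), i.e. the body of `KellerYin2024.thm421_rankOne_display_OPEN` AT THIS INSTANCE, now a
THEOREM from: the OPEN fact `h308` (KY Thm. 3.0.8 (IMC2) at `𝟙` ∘ BDP, the ONE preprint input), the
control theorem as proved `h511` ([CGLS] Thm. 5.1.1 under `E'(K)[p] = 0`), Gross–Zagier (`hGZ`),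
Kolyvagin (`hKo`), GZK (`hGZK`), modularity (`hmodP`: a parametrisation of level `N_E`; `hmod`: the
entire `L`-function). The Heegner datum is PRODUCED as in `display57_of_display55`
(`exists_dvd_sq_sub_discr_holds`, `nonempty_heegnerDatum_holds`, `heegnerPointComplex_mem_range_map_holds`);
the torsion terms vanish: `p ∤ #E'(ℚ)_tors` (`not_dvd_torsionOrder_of_noUnramifiedLine`) and
`p ∤ #E'^K(ℚ)_tors` (from `p ∤ #E'(K)_tors`, §1, through `ord_p #E'(K)_tors = ord_p #E'(ℚ)_tors +
ord_p #E'^K(ℚ)`, `padicValNat_torsionOrder_baseChange_quadratic`). KY's Appendix B is NOT used.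
[claim: KellerYin2024, status: under-review]
[cite: KellerYin2024, Thm. 4.2.1 and its proof (arXiv:2402.12781v2 §4.2), Thm. 3.0.8]
[cite: CastellaGrossiLeeSkinner2022, proof of Thm. 5.3.1 (5.4)–(5.7), Thm. 5.1.1 and its proof, Thm. 5.1.3] -/
theorem display_at_goodLattice (h308 : thm308_imc2_bdpValue_goodLattice_OPEN)
    (h511 : thm511_anticyclotomicControl_of_torsionFree)
    (hmodP : nonempty_modularParametrizationData)
    (hGZ : ∀ (N : ℕ) [NeZero N] (W : WeierstrassCurve ℚ) (K : Type) [Field K] [NumberField K],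
      gross_zagier N W K)
    (hKo : ∀ (N : ℕ) [NeZero N] (W : WeierstrassCurve ℚ) (K : Type) [Field K] [NumberField K],
      kolyvagin N W K)
    (hGZK : rank_eq_analyticRank_of_analyticRank_le_one) (hmod : hasEntireLFunction_rat)
    (W : WeierstrassCurve ℚ) [W.IsElliptic] [W.IsGloballyMinimal]
    (hp : 2 < p) (hgood : Good W p) (hred : Red W p) (han : Anom W p)
    (hGL : ∀ Φ : AddSubgroup (geomTorsion W (p : ℤ)), IsRationalLine W p Φ → ¬ LineUnramifiedAt W p Φ)
    (hr : W.analyticRank = 1)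
    (K : Type) [Field K] [NumberField K] (hK : IsImaginaryQuadratic K)
    (hodd : Odd (NumberField.discr K)) (hlt : NumberField.discr K < -4)
    (hHN : SatisfiesHeegnerHypothesis (W.conductorNorm ℤ) K) (hHp : SatisfiesHeegnerHypothesis p K)
    (hLt : (W.quadraticTwist (NumberField.discr K : ℚ)).entireLFunction 1 ≠ 0)
    (Wd : WeierstrassCurve ℚ) [Wd.IsElliptic] [Wd.IsGloballyMinimal]
    (hWd : ∃ C : VariableChange ℚ, C • Wd = W.quadraticTwist (NumberField.discr K : ℚ)) :
    ∀ (q qd : ℚ), W.leadingLCoeff / ((W.realPeriodRat * W.regulator : ℝ) : ℂ) = (q : ℂ) →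
        Wd.entireLFunction 1 / (Wd.realPeriodRat : ℂ) = (qd : ℂ) →
        padicValRat p q - ((padicValNat p W.shaOrder : ℤ) + padicValNat p W.tamagawaProduct -
            2 * padicValNat p W.torsionOrder) =
          -(padicValRat p qd - ((padicValNat p Wd.shaOrder : ℤ) + padicValNat p Wd.tamagawaProduct -
            2 * padicValNat p Wd.torsionOrder)) := by
  intro q qd hq hqd
  have hpp : p.Prime := Fact.out
  have hp2 : p ≠ 2 := by omega
  -- the Heegner datum of level `N_E`
  haveI : NeZero (W.conductorNorm ℤ) := ⟨(W.conductorNorm_pos_holds).ne'⟩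
  obtain ⟨Dt⟩ := hmodP W
  obtain ⟨β, hβ⟩ := exists_dvd_sq_sub_discr_holds (W.conductorNorm ℤ) K hK hHN
  obtain ⟨H, -⟩ := nonempty_heegnerDatum_holds (W.conductorNorm ℤ) K hK hβ
  obtain ⟨ι⟩ : Nonempty (K →+* ℂ) := inferInstance
  obtain ⟨P, hP⟩ := heegnerPointComplex_mem_range_map_holds (W.conductorNorm ℤ) W K hK hHN Dt H ι
  -- (5.7) without torsion terms for the good lattice (§3)
  have h57 := display57_at_goodLattice h308 h511 W p (W.conductorNorm ℤ) K Dt H ι P (hGZ _ W K)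
    (hKo _ W K) hGZK hmod hp hgood hred han hGL hr rfl hK hodd hlt hHN hHp hLt hP Wd hWd q qd hq hqd
  -- the torsion terms vanish: over `ℚ` for `E'` …
  have ht : padicValNat p W.torsionOrder = 0 :=
    padicValNat.eq_zero_of_not_dvd (not_dvd_torsionOrder_of_noUnramifiedLine hGL)
  -- … and for `E'^K`, through `ord_p #E'(K)_tors = ord_p #E'(ℚ)_tors + ord_p #E'^K(ℚ) = 0`
  obtain ⟨C, hC⟩ := hWd
  set Cd : VariableChange ℚ := C⁻¹ with hCd_def
  have hCd : Cd • W.quadraticTwist (NumberField.discr K : ℚ) = Wd := by rw [← hC, inv_smul_smul]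
  have hD0 : (NumberField.discr K : ℚ) ≠ 0 := by exact_mod_cast NumberField.discr_ne_zero K
  haveI hEt : (W.quadraticTwist (NumberField.discr K : ℚ)).IsElliptic :=
    W.isElliptic_quadraticTwist hD0
  have hrt : (W.quadraticTwist (NumberField.discr K : ℚ)).analyticRank = 0 :=
    ((W.quadraticTwist _).analyticRank_eq_zero_iff_holds (hmod _)).2 hLt
  have hrd : Wd.analyticRank = 0 := by rw [← hCd, analyticRank_smul, hrt]
  obtain ⟨hrankd, -⟩ := hGZK Wd (by omega)
  have hrkd : Wd.mordellWeilRank = 0 := by rw [hrankd, hrd]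
  haveI hfind : Finite Wd.toAffine.Point := Wd.mordellWeilRank_eq_zero_iff_holds.mp hrkd
  have htdeq : Wd.torsionOrder = Nat.card Wd.toAffine.Point := Wd.torsionOrder_eq_natCard_of_finite
  have h2 : Module.finrank ℚ K = 2 := hK.1
  obtain ⟨θ, c, hθ, hcθ⟩ := Quadratic.exists_sq_eq_algebraMap (F := ℚ) (K := K) h2
  obtain ⟨qq, hqq, hdq⟩ := NumberField.exists_discr_eq_mul_sq h2 hθ hcθ
  have htors : padicValNat p (W.baseChange K).torsionOrder =
      padicValNat p W.torsionOrder + padicValNat p (Nat.card Wd.toAffine.Point) :=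
    padicValNat_torsionOrder_baseChange_quadratic W K h2 hθ hcθ hqq hdq ⟨Cd, hCd⟩ p hp2
  have htK : padicValNat p (W.baseChange K).torsionOrder = 0 :=
    padicValNat.eq_zero_of_not_dvd (not_dvd_torsionOrder_baseChange_of_noUnramifiedLine hGL hK hHp)
  have htd : padicValNat p Wd.torsionOrder = 0 := by rw [htdeq]; omega
  rw [ht, htd]
  simp only [Nat.cast_zero, mul_zero, sub_zero]
  linarith

/-- **`BSD(E',p)` for the GOOD LATTICE of a rank-one type-A X1 pair — memo THEOREM A on KY's member of
the class.** For `W/ℚ` globally minimal elliptic with `ClassX1 W p` (`p > 2` good, `E[p]` reducible,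
`a_p ≡ 1 (mod p)`), parity type A (`¬ GVPar W p`), `ord_{s=1} L(E,s) = 1`, and KY's lattice
normalisation "no rational `p`-line of `E` is unramified at `p`" (`hGL`): Miller's `BSD(E,p)`. Inputs:
the ONE open hypothesis `h308` (Keller–Yin Thm. 3.0.8 (IMC2) at `𝟙` ∘ BDP, PREPRINT, verified in the
cell memo); PUBLISHED named facts: [CGLS] Thm. 5.1.1 as proved (`h511`), Greenberg–Vatsal 2000
Thm. 1.3 (`hGV`, Mazur's main conjecture for the TYPE-B partner `E'^K`: [CGLS] Thm. 5.1.4, tree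
`pPartRankZero_twist_of_not_gvPar`), Greenberg Thm. 4.1 (`hGr`), modularity (`hmodP`, `hmod`),
Hoffstein–Luo (`hHL`, the admissible `K`: `exists_admissibleField_of_rootNumber_eq_neg_one`),
Gross–Zagier (`hGZQ` over `ℚ`: `L'(E,1)/(Ω Reg) ∈ ℚ`; `hGZ` over `K`), Kolyvagin (`hKo`), GZK (`hGZK`).
Assembly: the display at `(E', p, K, Wd)` (`display_at_goodLattice`) + the partner's rank-`0` print
shape ⟹ `BSDp W p` (`bsdp_of_display_at_of_pPartRankZero`, x1a). No Schneider / `p`-adic height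
input (the road is anticyclotomic); no Appendix B; no cyclotomic main conjecture at type A.
[claim: KellerYin2024, status: under-review]
[cite: KellerYin2024, Thm. 4.2.1 (Theorem C) and its proof (arXiv:2402.12781v2 §4.2), Thm. 3.0.8]
[cite: CastellaGrossiLeeSkinner2022, Thm. 5.3.1 and its proof ((a)–(d), (5.4)–(5.7), last paragraph), Thms. 5.1.1–5.1.4]
[cite: GreenbergVatsal2000, Thm. (1.3)] [cite: HoffsteinLuo1997, Theorem (§1)]
[cite: GrossZagier1986, Thm. I.7.3, V.§2] [cite: Miller2011LMS, Def. 1.1] -/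
theorem bsdp_goodLattice_of_not_gvPar_of_analyticRank_eq_one
    (h308 : thm308_imc2_bdpValue_goodLattice_OPEN) (h511 : thm511_anticyclotomicControl_of_torsionFree)
    (hGV : GreenbergVatsal2000.thm13_charIdeal_eq_of_gvPar) (hGr : greenberg_charValue_rankZero)
    (hmodP : nonempty_modularParametrizationData) (hmod : exists_isNewformOf)
    (hHL : HoffsteinLuo1997_exists_twist_L_one_ne_zero) (hGZQ : GrossZagier1986_thm_I_7_3)
    (hGZ : ∀ (N : ℕ) [NeZero N] (W : WeierstrassCurve ℚ) (K : Type) [Field K] [NumberField K],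
      gross_zagier N W K)
    (hKo : ∀ (N : ℕ) [NeZero N] (W : WeierstrassCurve ℚ) (K : Type) [Field K] [NumberField K],
      kolyvagin N W K)
    (hGZK : rank_eq_analyticRank_of_analyticRank_le_one)
    (W : WeierstrassCurve ℚ) [W.IsElliptic] [W.IsGloballyMinimal]
    (hX1 : ClassX1 W p) (hA : ¬ GVPar W p)
    (hGL : ∀ Φ : AddSubgroup (geomTorsion W (p : ℤ)), IsRationalLine W p Φ → ¬ LineUnramifiedAt W p Φ)
    (hr : W.analyticRank = 1) : BSDp W p := by
  obtain ⟨hp, hred, hgood, han, -⟩ := hX1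
  have hmod' : hasEntireLFunction_rat := hasEntireLFunction_rat_of_exists_isNewformOf hmod
  -- `w(E) = -1` from `ord_{s=1} L(E,s) = 1`
  have hw : W.rootNumber = -1 := by
    have h := even_analyticRank_iff_rootNumber_eq_one.rootNumber_eq_neg_one_pow (W := W)
      (even_analyticRank_iff_rootNumber_eq_one_of_exists_isNewformOf W hmod)
    rw [hr, pow_one] at h
    exact h
  -- the admissible auxiliary field `K` ((a)–(d)) and a globally minimal model `Wd` of `E^{(D_K)}`
  obtain ⟨K, _, _, hK, hodd, hlt, hHN, hHp, hLK⟩ :=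
    exists_admissibleField_of_rootNumber_eq_neg_one hmod hHL W hw p
  have hd0 : (NumberField.discr K : ℚ) ≠ 0 := by
    exact_mod_cast (show NumberField.discr K ≠ 0 by omega)
  obtain ⟨Wd, _, _, C, hC⟩ := exists_isGloballyMinimal_smul_eq_quadraticTwist W hd0
  -- the partner's rank-`0` print shape: Greenberg–Vatsal on the type-B twist
  have hP : PPartRankZero Wd p :=
    pPartRankZero_twist_of_not_gvPar hGV hGr hmodP hGZK W p ⟨hp, hred, hgood, han, fun h ↦ by omega⟩ hA
      K hK hodd hHp hLK Wd ⟨C, hC⟩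
  -- the display at `(E', p, K, Wd)`, then `BSD(E',p)`
  exact bsdp_of_display_at_of_pPartRankZero hmod hGZQ hGZK W p hr Wd hP
    (display_at_goodLattice h308 h511 hmodP hGZ hKo hGZK hmod' W hp hgood hred han hGL hr K hK hodd hlt
      hHN hHp hLK Wd ⟨C, hC⟩)

end Assembly

/-! ## §3 Every member of the isogeny class: Cassels (memo L1) -/

section Transport

variable {p : ℕ} [Fact p.Prime]

/-- **THEOREM A modulo the existence of the good lattice in the class — `BSD(E,p)` for EVERY member
of a rank-one type-A X1 isogeny class that contains a KY-normalised member** (memo L1 = Cassels'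
isogeny invariance of the BSD quotient, Milne ADT I.7.3, named fact `hCassels`; the existence of the
normalised member `W` — "by Ribet's lemma", KY Prop. 1.3.1 — is the hypothesis `hiso` + `hGL`, a
finite check per class: e.g. `11a2` for `{11a1, 11a2, 11a3}` at `5`). Hypotheses on the CENSUS curve
`V`: `ClassX1 V p`, `¬ GVPar V p`, `ord_{s=1} L(V,s) = 1`; they transport to `W` (`ClassX1.of_isIsogenous`,
`gvPar_iff_of_isIsogenous_of_anom`, `analyticRank_eq_of_isIsogenous'`), §4 gives `BSD(W,p)`, and
`Wuthrich2014.bsdp_of_isIsogenous` carries it back (`Ш(W)` finite by GZK, `L'(W,1) ≠ 0` by modularity).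
Inputs: the ONE open hypothesis `h308` [PRE, KY Thm. 3.0.8 at `𝟙` ∘ BDP]; published named facts
`h511` (CGLS 5.1.1 as proved), `hCassels`, `hGV` (GV 2000 Thm. 1.3), `hGr` (Greenberg Thm. 4.1),
`hmodP`/`hmod` (modularity), `hHL` (Hoffstein–Luo), `hGZQ`/`hGZ` (Gross–Zagier), `hKo` (Kolyvagin),
`hGZK`. [claim: KellerYin2024, status: under-review]
[cite: KellerYin2024, Thm. 4.2.1 (Theorem C) and its proof (arXiv:2402.12781v2 §4.2), Prop. 1.3.1]
[cite: MilneADT2006, Thm. I.7.3 and Remark I.7.4] [cite: CastellaGrossiLeeSkinner2022, Thm. 5.3.1 and its proof]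
[cite: GreenbergVatsal2000, Thm. (1.3)] -/
theorem bsdp_of_isIsogenous_goodLattice_of_not_gvPar_of_analyticRank_eq_one
    (h308 : thm308_imc2_bdpValue_goodLattice_OPEN) (h511 : thm511_anticyclotomicControl_of_torsionFree)
    (hCassels : bsdRHS_eq_of_isIsogenous)
    (hGV : GreenbergVatsal2000.thm13_charIdeal_eq_of_gvPar) (hGr : greenberg_charValue_rankZero)
    (hmodP : nonempty_modularParametrizationData) (hmod : exists_isNewformOf)
    (hHL : HoffsteinLuo1997_exists_twist_L_one_ne_zero) (hGZQ : GrossZagier1986_thm_I_7_3)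
    (hGZ : ∀ (N : ℕ) [NeZero N] (W : WeierstrassCurve ℚ) (K : Type) [Field K] [NumberField K],
      gross_zagier N W K)
    (hKo : ∀ (N : ℕ) [NeZero N] (W : WeierstrassCurve ℚ) (K : Type) [Field K] [NumberField K],
      kolyvagin N W K)
    (hGZK : rank_eq_analyticRank_of_analyticRank_le_one)
    (V : WeierstrassCurve ℚ) [V.IsElliptic] [V.IsGloballyMinimal]
    (hX1 : ClassX1 V p) (hA : ¬ GVPar V p) (hr : V.analyticRank = 1)
    (W : WeierstrassCurve ℚ) [W.IsElliptic] [W.IsGloballyMinimal] (hiso : IsIsogenous V W)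
    (hGL : ∀ Φ : AddSubgroup (geomTorsion W (p : ℤ)), IsRationalLine W p Φ → ¬ LineUnramifiedAt W p Φ) :
    BSDp V p := by
  have hp2 : p ≠ 2 := by have := hX1.1; omega
  have hX1' : ClassX1 W p := ClassX1.of_isIsogenous hiso hX1
  have hA' : ¬ GVPar W p := fun h ↦
    hA ((gvPar_iff_of_isIsogenous_of_anom hp2 hX1.2.2.2.1 hX1'.2.2.2.1 hiso).mpr h)
  have hr' : W.analyticRank = 1 := (analyticRank_eq_of_isIsogenous' hiso).symm.trans hr
  have hB' : BSDp W p := bsdp_goodLattice_of_not_gvPar_of_analyticRank_eq_one h308 h511 hGV hGr hmodP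
    hmod hHL hGZQ hGZ hKo hGZK W hX1' hA' hGL hr'
  obtain ⟨-, hfin'⟩ := hGZK W (by omega)
  have hlead' : W.leadingLCoeff ≠ 0 :=
    WeierstrassCurve.leadingLCoeff_ne_zero_holds (hasEntireLFunction_rat_of_exists_isNewformOf hmod W)
  exact Wuthrich2014.bsdp_of_isIsogenous hCassels hiso hfin' hlead' hB'

end Transport

end Summit.BirchSwinnertonDyer.Rank1Residual.X1.KellerYinTheoremA

end
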